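import Literature.MathematicalPhysics.QuantumFieldTheory.ConformalBootstrap3D.PointFunctionalTermwise
import Literature.MathematicalPhysics.QuantumFieldTheory.ConformalBootstrap3D.HRCoeffCellBounds

/-!
# Head cells for point functionals (architecture B″, obligations (O2)–(O4))

The light-block obligations of a point-functional certificate are `Δ`-CELL statements: for a spin
`ℓ` and a cell `[a, b]` of dimensions, `φ[F^{s}_{-}[g_{Δ,ℓ}]] ≥ 0` for every `Δ` in the cell and
every external dimension `s ∈ [s_lo, s_hi]`. With the termwise action
(`hasSum_pointFunctional_crossF_hrZ`)

  `φ[F^{s}_{-}[g_{Δ,ℓ}]] = Σ_{(n,j)} (A_{n,j}(Δ)/λ_ℓ) Φ(Δ+n, j, s)`,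

a finite head set `F` of indices, the two-sided cell bounds `A_{n,j}(Δ) ∈ [A⁻_{n,j}, A⁺_{n,j}]`
(`hrCoeff_mem_Icc_cell`: endpoint evaluations times pivot-product ratios) and the corner bound
`Φ(E, j, s) ≥ Φ⁻_{n,j}` on `E ∈ [a+n, b+n]`, `s ∈ [s_lo, s_hi]` (`termCornerBound_le`), ONE number
decides the cell:

  `headCellBound = Σ_{(n,j) ∈ F} min(A⁻_{n,j} Φ⁻_{n,j}, A⁺_{n,j} Φ⁻_{n,j}) ≥ 0`

together with termwise non-negativity of the terms outside `F` (rules (M)/(T) when `a + n ≥ E₀`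
off `F`): `blockPositive_pointFunctional_of_headSum[_Ico]` (any table `Φlo` of per-term lower
bounds — corner bounds here, sharper second-order box bounds elsewhere), its corner instance
`blockPositive_pointFunctional_of_headCell` (regular `Δ` in the closed cell),
`blockPositive_pointFunctional_of_headCell_Ico` (every `Δ` in the half-open cell, non-regular
points by the limit clause), `headSum/headCell_pointFunctional_of_pointRules` (the tail terms
discharged by the certificate's global (M)/(T) data), and the gluing of consecutive half-open
cells into the (O2)/(O3)/(O4) fields (`blockPositive_of_cells_Ico`, `epsilon_nonneg_of_cells`,
`scalar_nonneg_of_cells`, `spinning_nonneg_of_cells`).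

Cells may start AT the unitarity bound `a = ℓ + 1` (`ℓ ≥ 1`); for `ℓ = 0` they must have `a ≥ 1`
(the physical ones start at `Δ_ε ≥ 1.41`). The slack of the cell bounds is the pivot-product ratio
`P_n(b)/P_n(a)` (`≈ 1 + c·n·(b-a)`), so head cells have to be narrow at high levels; this is a
rigorous rule whose cost (K57 certificate, floats, `Δ_σ`-box of width `10⁻³`, corner term bounds)
is cells of width `2⁻⁶ … 2⁻²` away from the extremal corner and NO width at the corner itself
(`ℓ = 0`, `a = 1.7`: there the corner bounds in `s` are too weak and second-order box bounds are
needed — supplied to `headCellSum` as another table `Φlo`). Term basis: Hogervorst–Rychkov 2013, §3.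
[cite: HogervorstRychkov2013, §3 eq. (3.9)]
-/

noncomputable section

namespace Literature.MathematicalPhysics.QuantumFieldTheory.ConformalBootstrap3D

open Finset Set Filter Topology

/-! ### One number per cell -/

/-- `min(A⁻Φ⁻, A⁺Φ⁻) ≤ A·Φ` whenever `A ∈ [A⁻, A⁺]`, `A ≥ 0`, `Φ ≥ Φ⁻`. [folklore] -/
theorem min_mul_le_mul_of_bounds {A Alo Ahi Φ Φlo : ℝ} (h1 : Alo ≤ A) (h2 : A ≤ Ahi) (hA : 0 ≤ A)
    (hΦ : Φlo ≤ Φ) : min (Alo * Φlo) (Ahi * Φlo) ≤ A * Φ := by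
  have hAΦ : A * Φlo ≤ A * Φ := mul_le_mul_of_nonneg_left hΦ hA
  rcases le_or_gt 0 Φlo with hpos | hneg
  · exact (min_le_left _ _).trans ((mul_le_mul_of_nonneg_right h1 hpos).trans hAΦ)
  · refine (min_le_right _ _).trans (le_trans ?_ hAΦ)
    have : 0 ≤ (Ahi - A) * (-Φlo) := mul_nonneg (by linarith) (by linarith)
    nlinarith

/-- The head-cell sum for spin `ℓ`, cell `[a, b]`, head index set `F` and ANY table of per-term lower
bounds `Φlo (n, j) ≤ Φ(Δ + n, j, s)` (`Δ ∈ [a, b]`):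
`Σ_{(n,j) ∈ F} min(A⁻_{n,j} Φlo_{n,j}, A⁺_{n,j} Φlo_{n,j})`,
`A⁻ = A_{n,j}(a) P_n(a)/P_n(b)`, `A⁺ = A_{n,j}(b) P_n(b)/P_n(a)` (`hrCoeff_mem_Icc_cell`).
[cite: HogervorstRychkov2013, §3 eq. (3.9)] -/
def headCellSum (ℓ : ℕ) (a b : ℝ) (F : Finset (ℕ × ℕ)) (Φlo : ℕ × ℕ → ℝ) : ℝ :=
  ∑ q ∈ F, min
    (hrCoeff a ℓ q.1 q.2 * (pivotProd a ℓ q.1 / pivotProd b ℓ q.1) * Φlo q)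
    (hrCoeff b ℓ q.1 q.2 * (pivotProd b ℓ q.1 / pivotProd a ℓ q.1) * Φlo q)

/-- **Head cell rule with a table of term bounds, regular points.** Nodes in the open square,
`ℓ + 1 ≤ a`; if `Φlo` bounds the head terms from below on the cell, `headCellSum ≥ 0`, and every term
outside `F` on the descendant range is non-negative for `E ∈ [a+n, b+n]`, then `φ` is block-positive
at every REGULAR `Δ ∈ [a, b]`. [cite: HogervorstRychkov2013, §3 eq. (3.9)] -/
theorem blockPositive_pointFunctional_of_headSum {N : ℕ} (w z zb : Fin N → ℝ)
    (hz : ∀ k, z k ∈ Ioo (0 : ℝ) 1) (hzb : ∀ k, zb k ∈ Ioo (0 : ℝ) 1) {ℓ : ℕ} {a b s : ℝ}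
    (ha : (ℓ : ℝ) + 1 ≤ a) (F : Finset (ℕ × ℕ)) (Φlo : ℕ × ℕ → ℝ)
    (hΦ : ∀ q ∈ F, ∀ Δ ∈ Icc a b,
      Φlo q ≤ pointFunctional w z zb (crossF s (-1) (zMono (Δ + (q.1 : ℝ)) q.2)))
    (hhead : 0 ≤ headCellSum ℓ a b F Φlo)
    (htail : ∀ q : ℕ × ℕ, q ∉ F → InDescendantRange ℓ q.1 q.2 →
      ∀ E ∈ Icc (a + q.1) (b + q.1), 0 ≤ pointFunctional w z zb (crossF s (-1) (zMono E q.2))) :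
    ∀ Δ ∈ Icc a b, IsRegularPoint3D Δ ℓ → BlockPositive (pointFunctional w z zb) s Δ ℓ := by
  intro Δ hΔ hreg
  have hbd : unitarityBound3D ℓ ≤ Δ := ((unitarityBound3D_le_add_one ℓ).trans ha).trans hΔ.1
  have hlt : unitarityBound3D ℓ < Δ := lt_of_le_of_ne hbd (fun h => hreg.1 h.symm)
  refine blockPositive_pointFunctional_of_termwise w z zb hz hzb hlt hreg.2 F ?_ ?_
  · -- the head
    have hlam : 0 < legendreLam ℓ := legendreLam_pos ℓ
    have hterm : ∀ q ∈ F,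
        (1 / legendreLam ℓ) * min
          (hrCoeff a ℓ q.1 q.2 * (pivotProd a ℓ q.1 / pivotProd b ℓ q.1) * Φlo q)
          (hrCoeff b ℓ q.1 q.2 * (pivotProd b ℓ q.1 / pivotProd a ℓ q.1) * Φlo q) ≤
        hrCoeff Δ ℓ q.1 q.2 / legendreLam ℓ *
          pointFunctional w z zb (crossF s (-1) (zMono (Δ + (q.1 : ℝ)) q.2)) := by
      intro q hq
      have hA := hrCoeff_mem_Icc_cell ha hΔ.1 hΔ.2 q.1 q.2
      have hmin := min_mul_le_mul_of_bounds hA.1 hA.2 (hrCoeff_nonneg_of_le (ha.trans hΔ.1) _ _)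
        (hΦ q hq Δ hΔ)
      have hrw : hrCoeff Δ ℓ q.1 q.2 / legendreLam ℓ *
          pointFunctional w z zb (crossF s (-1) (zMono (Δ + (q.1 : ℝ)) q.2)) =
          (1 / legendreLam ℓ) * (hrCoeff Δ ℓ q.1 q.2 *
            pointFunctional w z zb (crossF s (-1) (zMono (Δ + (q.1 : ℝ)) q.2))) := by ring
      rw [hrw]
      exact mul_le_mul_of_nonneg_left hmin (by positivity)
    calc (0 : ℝ) ≤ (1 / legendreLam ℓ) * headCellSum ℓ a b F Φlo := mul_nonneg (by positivity) hhead
      _ = ∑ q ∈ F, (1 / legendreLam ℓ) * min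
          (hrCoeff a ℓ q.1 q.2 * (pivotProd a ℓ q.1 / pivotProd b ℓ q.1) * Φlo q)
          (hrCoeff b ℓ q.1 q.2 * (pivotProd b ℓ q.1 / pivotProd a ℓ q.1) * Φlo q) := by
          rw [headCellSum, Finset.mul_sum]
      _ ≤ _ := Finset.sum_le_sum hterm
  · -- the tail
    intro q hq hr
    exact htail q hq hr (Δ + (q.1 : ℝ)) ⟨by linarith [hΔ.1], by linarith [hΔ.2]⟩

/-- **Head cell rule with a table of term bounds, half-open cell**: every `Δ ∈ [a, b)`, the
non-regular points by the limit clause from the regular points to their right inside the cell.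
[cite: HogervorstRychkov2013, §3 eq. (3.9)] -/
theorem blockPositive_pointFunctional_of_headSum_Ico {N : ℕ} (w z zb : Fin N → ℝ)
    (hz : ∀ k, z k ∈ Ioo (0 : ℝ) 1) (hzb : ∀ k, zb k ∈ Ioo (0 : ℝ) 1) {ℓ : ℕ} {a b s : ℝ}
    (ha : (ℓ : ℝ) + 1 ≤ a) (F : Finset (ℕ × ℕ)) (Φlo : ℕ × ℕ → ℝ)
    (hΦ : ∀ q ∈ F, ∀ Δ ∈ Icc a b,
      Φlo q ≤ pointFunctional w z zb (crossF s (-1) (zMono (Δ + (q.1 : ℝ)) q.2)))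
    (hhead : 0 ≤ headCellSum ℓ a b F Φlo)
    (htail : ∀ q : ℕ × ℕ, q ∉ F → InDescendantRange ℓ q.1 q.2 →
      ∀ E ∈ Icc (a + q.1) (b + q.1), 0 ≤ pointFunctional w z zb (crossF s (-1) (zMono E q.2))) :
    ∀ Δ ∈ Ico a b, BlockPositive (pointFunctional w z zb) s Δ ℓ := by
  intro Δ hΔ
  have hreg := blockPositive_pointFunctional_of_headSum w z zb hz hzb ha F Φlo hΦ hhead htail
  by_cases hr : IsRegularPoint3D Δ ℓ
  · exact hreg Δ ⟨hΔ.1, hΔ.2.le⟩ hr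
  · have hbd : unitarityBound3D ℓ ≤ Δ := ((unitarityBound3D_le_add_one ℓ).trans ha).trans hΔ.1
    refine blockPositive_of_eventually_right w z zb hz hzb s Δ ℓ hr ?_
    filter_upwards [eventually_isRegularPoint3D_nhdsGT_of_bound_le hbd, Ioo_mem_nhdsGT hΔ.2]
      with Δ' hΔ'reg hΔ'
    exact ⟨hΔ'reg, hreg Δ' ⟨hΔ.1.trans hΔ'.1.le, hΔ'.2.le⟩ hΔ'reg⟩

/-- The head-cell number of a point functional for spin `ℓ`, cell `[a, b]`, external box
`[s_lo, s_hi]` and head index set `F`: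
`Σ_{(n,j) ∈ F} min(A⁻_{n,j} Φ⁻_{n,j}, A⁺_{n,j} Φ⁻_{n,j})` with
`A⁻ = A_{n,j}(a) P_n(a)/P_n(b)`, `A⁺ = A_{n,j}(b) P_n(b)/P_n(a)`, `Φ⁻ = termCornerBound … j (a+n) (b+n) s_lo s_hi`.
[cite: HogervorstRychkov2013, §3 eq. (3.9)] -/
def headCellBound {N : ℕ} (w z zb : Fin N → ℝ) (ℓ : ℕ) (a b slo shi : ℝ)
    (F : Finset (ℕ × ℕ)) : ℝ :=
  ∑ q ∈ F, min
    (hrCoeff a ℓ q.1 q.2 * (pivotProd a ℓ q.1 / pivotProd b ℓ q.1) *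
      termCornerBound w z zb q.2 (a + q.1) (b + q.1) slo shi)
    (hrCoeff b ℓ q.1 q.2 * (pivotProd b ℓ q.1 / pivotProd a ℓ q.1) *
      termCornerBound w z zb q.2 (a + q.1) (b + q.1) slo shi)

/-- The corner head-cell number is the head-cell sum with the corner term bounds. [folklore] -/
theorem headCellBound_eq_headCellSum {N : ℕ} (w z zb : Fin N → ℝ) (ℓ : ℕ) (a b slo shi : ℝ)
    (F : Finset (ℕ × ℕ)) :
    headCellBound w z zb ℓ a b slo shi F =
      headCellSum ℓ a b F (fun q => termCornerBound w z zb q.2 (a + q.1) (b + q.1) slo shi) := rfl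

/-- **Head cell rule (corner bounds), regular points.** Nodes in the open square, `ℓ + 1 ≤ a`,
`s ∈ [s_lo, s_hi]`; if `headCellBound ≥ 0` and every term outside `F` on the descendant range is
non-negative for `E ∈ [a+n, b+n]`, then `φ` is block-positive at every REGULAR `Δ ∈ [a, b]`.
[cite: HogervorstRychkov2013, §3 eq. (3.9)] -/
theorem blockPositive_pointFunctional_of_headCell {N : ℕ} (w z zb : Fin N → ℝ)
    (hz : ∀ k, z k ∈ Ioo (0 : ℝ) 1) (hzb : ∀ k, zb k ∈ Ioo (0 : ℝ) 1) {ℓ : ℕ} {a b slo shi s : ℝ}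
    (ha : (ℓ : ℝ) + 1 ≤ a) (hs : s ∈ Icc slo shi) (F : Finset (ℕ × ℕ))
    (hhead : 0 ≤ headCellBound w z zb ℓ a b slo shi F)
    (htail : ∀ q : ℕ × ℕ, q ∉ F → InDescendantRange ℓ q.1 q.2 →
      ∀ E ∈ Icc (a + q.1) (b + q.1), 0 ≤ pointFunctional w z zb (crossF s (-1) (zMono E q.2))) :
    ∀ Δ ∈ Icc a b, IsRegularPoint3D Δ ℓ → BlockPositive (pointFunctional w z zb) s Δ ℓ :=
  blockPositive_pointFunctional_of_headSum w z zb hz hzb ha F _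
    (fun q _ Δ hΔ => termCornerBound_le w z zb hz hzb q.2
      (⟨by linarith [hΔ.1], by linarith [hΔ.2]⟩ : Δ + (q.1 : ℝ) ∈ Icc (a + q.1) (b + q.1)) hs)
    (by rwa [headCellBound_eq_headCellSum] at hhead) htail

/-- **Head cell rule (corner bounds), half-open cell.** Same hypotheses; conclusion for EVERY
`Δ ∈ [a, b)`, the non-regular points (the bound `a = ℓ + 1` itself, accidental degeneracies) by the
limit clause from the regular points to their right inside the cell.
[cite: HogervorstRychkov2013, §3 eq. (3.9)] -/
theorem blockPositive_pointFunctional_of_headCell_Ico {N : ℕ} (w z zb : Fin N → ℝ)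
    (hz : ∀ k, z k ∈ Ioo (0 : ℝ) 1) (hzb : ∀ k, zb k ∈ Ioo (0 : ℝ) 1) {ℓ : ℕ} {a b slo shi s : ℝ}
    (ha : (ℓ : ℝ) + 1 ≤ a) (hs : s ∈ Icc slo shi) (F : Finset (ℕ × ℕ))
    (hhead : 0 ≤ headCellBound w z zb ℓ a b slo shi F)
    (htail : ∀ q : ℕ × ℕ, q ∉ F → InDescendantRange ℓ q.1 q.2 →
      ∀ E ∈ Icc (a + q.1) (b + q.1), 0 ≤ pointFunctional w z zb (crossF s (-1) (zMono E q.2))) :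
    ∀ Δ ∈ Ico a b, BlockPositive (pointFunctional w z zb) s Δ ℓ :=
  blockPositive_pointFunctional_of_headSum_Ico w z zb hz hzb ha F _
    (fun q _ Δ hΔ => termCornerBound_le w z zb hz hzb q.2
      (⟨by linarith [hΔ.1], by linarith [hΔ.2]⟩ : Δ + (q.1 : ℝ) ∈ Icc (a + q.1) (b + q.1)) hs)
    (by rwa [headCellBound_eq_headCellSum] at hhead) htail

/-- **Head cell from the certificate's global data (any table of term bounds).** The external
dimension runs over `Q` (`s = p.1 ∈ [s_lo, s_hi]`), `Φlo` bounds the head terms from below for all of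
them, and the tail terms are discharged by the certificate's rules: every index outside `F` on the
descendant range has `a + n ≥ E₀`, (M) gives termwise positivity on `[E₀, E_T)` and (T) (apex
domination) from `E_T` on. [cite: HogervorstRychkov2013, §3 eq. (3.9)] -/
theorem headSum_pointFunctional_of_pointRules {N : ℕ} (w z zb : Fin N → ℝ)
    (hz : ∀ k, z k ∈ Ioo (0 : ℝ) 1) (hzb : ∀ k, zb k ∈ Ioo (0 : ℝ) 1) (hord : ∀ k, zb k ≤ z k)
    (apex : Fin N) (hapex : 0 ≤ w apex) (qd qr : Fin N → ℝ) (hqd : ∀ k, 0 < qd k ∧ qd k ≤ 1)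
    (hqr : ∀ k, 0 < qr k ∧ qr k ≤ 1)
    (hdomd : ∀ k, z k * zb k ≤ qd k ^ 2 * (z apex * zb apex) ∧ z k ≤ qd k * z apex)
    (hdomr : ∀ k, (1 - z k) * (1 - zb k) ≤ qr k ^ 2 * (z apex * zb apex) ∧
      1 - zb k ≤ qr k * z apex)
    {Q : Set (ℝ × ℝ)} {slo shi E₀ ET : ℝ} (hQ : ∀ p ∈ Q, slo ≤ p.1 ∧ p.1 ≤ shi)
    (hM : ∀ (j : ℕ) (E : ℝ), E₀ ≤ E → E < ET → (j : ℝ) + 1 / 2 ≤ E → ∀ p ∈ Q,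
      0 ≤ pointFunctional w z zb (crossF p.1 (-1) (zMono E j)))
    (hB : ∑ k ∈ univ.erase apex, |w k| * ((1 - z k) * (1 - zb k)) ^ slo * qd k ^ ET
          + ∑ k, |w k| * (z k * zb k) ^ slo * qr k ^ ET ≤
          w apex * ((1 - z apex) * (1 - zb apex)) ^ shi)
    {ℓ : ℕ} {a b : ℝ} (ha : (ℓ : ℝ) + 1 ≤ a) (F : Finset (ℕ × ℕ))
    (hF : ∀ q : ℕ × ℕ, q ∉ F → InDescendantRange ℓ q.1 q.2 → E₀ ≤ a + q.1)
    (Φlo : ℕ × ℕ → ℝ)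
    (hΦ : ∀ q ∈ F, ∀ Δ ∈ Icc a b, ∀ p ∈ Q,
      Φlo q ≤ pointFunctional w z zb (crossF p.1 (-1) (zMono (Δ + (q.1 : ℝ)) q.2)))
    (hhead : 0 ≤ headCellSum ℓ a b F Φlo) :
    ∀ p ∈ Q, ∀ Δ ∈ Ico a b, BlockPositive (pointFunctional w z zb) p.1 Δ ℓ := by
  intro p hp
  refine blockPositive_pointFunctional_of_headSum_Ico w z zb hz hzb ha F Φlo
    (fun q hq Δ hΔ => hΦ q hq Δ hΔ p hp) hhead ?_
  intro q hq hr E hE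
  have hjb : (q.2 : ℝ) + 1 / 2 ≤ E := by
    have h1 : q.2 ≤ ℓ + q.1 := hr.2.1
    have h2 : (q.2 : ℝ) ≤ (ℓ : ℝ) + q.1 := by exact_mod_cast h1
    linarith [hE.1]
  have hE0 : E₀ ≤ E := (hF q hq hr).trans hE.1
  by_cases hET : E < ET
  · exact hM q.2 E hE0 hET hjb p hp
  · have hBs := apexIneq_of_box w z zb hz hzb apex hapex qd qr (fun k => (hqd k).1.le)
      (fun k => (hqr k).1.le) (hQ p hp) hB
    exact term_nonneg_of_apex w z zb hz hzb hord apex qd qr hqd hqr hdomd hdomr hBs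
      (by linarith) (not_lt.1 hET)

/-- **Head cell from the certificate's global data (corner bounds).** As above with the corner
term bounds: ONE number `headCellBound w z z̄ ℓ a b s_lo s_hi F ≥ 0` per cell.
[cite: HogervorstRychkov2013, §3 eq. (3.9)] -/
theorem headCell_pointFunctional_of_pointRules {N : ℕ} (w z zb : Fin N → ℝ)
    (hz : ∀ k, z k ∈ Ioo (0 : ℝ) 1) (hzb : ∀ k, zb k ∈ Ioo (0 : ℝ) 1) (hord : ∀ k, zb k ≤ z k)
    (apex : Fin N) (hapex : 0 ≤ w apex) (qd qr : Fin N → ℝ) (hqd : ∀ k, 0 < qd k ∧ qd k ≤ 1)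
    (hqr : ∀ k, 0 < qr k ∧ qr k ≤ 1)
    (hdomd : ∀ k, z k * zb k ≤ qd k ^ 2 * (z apex * zb apex) ∧ z k ≤ qd k * z apex)
    (hdomr : ∀ k, (1 - z k) * (1 - zb k) ≤ qr k ^ 2 * (z apex * zb apex) ∧
      1 - zb k ≤ qr k * z apex)
    {Q : Set (ℝ × ℝ)} {slo shi E₀ ET : ℝ} (hQ : ∀ p ∈ Q, slo ≤ p.1 ∧ p.1 ≤ shi)
    (hM : ∀ (j : ℕ) (E : ℝ), E₀ ≤ E → E < ET → (j : ℝ) + 1 / 2 ≤ E → ∀ p ∈ Q,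
      0 ≤ pointFunctional w z zb (crossF p.1 (-1) (zMono E j)))
    (hB : ∑ k ∈ univ.erase apex, |w k| * ((1 - z k) * (1 - zb k)) ^ slo * qd k ^ ET
          + ∑ k, |w k| * (z k * zb k) ^ slo * qr k ^ ET ≤
          w apex * ((1 - z apex) * (1 - zb apex)) ^ shi)
    {ℓ : ℕ} {a b : ℝ} (ha : (ℓ : ℝ) + 1 ≤ a) (F : Finset (ℕ × ℕ))
    (hF : ∀ q : ℕ × ℕ, q ∉ F → InDescendantRange ℓ q.1 q.2 → E₀ ≤ a + q.1)
    (hhead : 0 ≤ headCellBound w z zb ℓ a b slo shi F) :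
    ∀ p ∈ Q, ∀ Δ ∈ Ico a b, BlockPositive (pointFunctional w z zb) p.1 Δ ℓ :=
  headSum_pointFunctional_of_pointRules w z zb hz hzb hord apex hapex qd qr hqd hqr hdomd hdomr hQ hM
    hB ha F hF _
    (fun q _ Δ hΔ p hp => termCornerBound_le w z zb hz hzb q.2
      (⟨by linarith [hΔ.1], by linarith [hΔ.2]⟩ : Δ + (q.1 : ℝ) ∈ Icc (a + q.1) (b + q.1))
      ⟨(hQ p hp).1, (hQ p hp).2⟩)
    (by rwa [headCellBound_eq_headCellSum] at hhead)

/-! ### Gluing half-open cells into the obligation fields -/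

/-- Consecutive half-open cells cover `[t₀, t_K)` (no monotonicity of `t` needed).  [folklore] -/
theorem blockPositive_of_cells_Ico {φ : (ℝ → ℝ → ℝ) →ₗ[ℝ] ℝ} {Q : Set (ℝ × ℝ)} {ℓ : ℕ}
    (t : ℕ → ℝ) :
    ∀ K : ℕ, (∀ k < K, ∀ p ∈ Q, ∀ Δ ∈ Ico (t k) (t (k + 1)), BlockPositive φ p.1 Δ ℓ) →
      ∀ p ∈ Q, ∀ Δ ∈ Ico (t 0) (t K), BlockPositive φ p.1 Δ ℓ := by
  intro K
  induction K with
  | zero => intro _ p _ Δ hΔ; exact absurd hΔ.2 (not_lt.2 hΔ.1)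
  | succ K ih =>
    intro hcell p hp Δ hΔ
    by_cases hK : Δ < t K
    · exact ih (fun k hk => hcell k (by omega)) p hp Δ ⟨hΔ.1, hK⟩
    · exact hcell K (by omega) p hp Δ ⟨not_lt.1 hK, hΔ.2⟩

/-- (O2) from half-open scalar cells covering the `Δ_ε`-range of the box:
`t₀ ≤ Δ_ε < t_K` for every `(Δ_σ, Δ_ε) ∈ Q`. [folklore] -/
theorem epsilon_nonneg_of_cells {φ : (ℝ → ℝ → ℝ) →ₗ[ℝ] ℝ} {Q : Set (ℝ × ℝ)} (t : ℕ → ℝ) (K : ℕ)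
    (hQ : ∀ p ∈ Q, t 0 ≤ p.2 ∧ p.2 < t K)
    (hcell : ∀ k < K, ∀ p ∈ Q, ∀ Δ ∈ Ico (t k) (t (k + 1)), BlockPositive φ p.1 Δ 0) :
    ∀ p ∈ Q, BlockPositive φ p.1 p.2 0 :=
  fun p hp => blockPositive_of_cells_Ico t K hcell p hp p.2 ⟨(hQ p hp).1, (hQ p hp).2⟩

/-- (O3) from half-open scalar cells with `t₀ ≤ 3` and `t_K = Δ⋆`. [folklore] -/
theorem scalar_nonneg_of_cells {φ : (ℝ → ℝ → ℝ) →ₗ[ℝ] ℝ} {Q : Set (ℝ × ℝ)} {Δstar : ℝ}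
    (t : ℕ → ℝ) (K : ℕ) (h0 : t 0 ≤ 3) (hK : t K = Δstar)
    (hcell : ∀ k < K, ∀ p ∈ Q, ∀ Δ ∈ Ico (t k) (t (k + 1)), BlockPositive φ p.1 Δ 0) :
    ∀ p ∈ Q, ∀ Δ : ℝ, 3 ≤ Δ → Δ < Δstar → BlockPositive φ p.1 Δ 0 :=
  fun p hp Δ h3 hlt => blockPositive_of_cells_Ico t K hcell p hp Δ ⟨h0.trans h3, hK ▸ hlt⟩

/-- (O4) from half-open spinning cells: spins bounded by `L` (`Δ⋆ ≤ L + 1`), and for each even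
`0 < ℓ < L` a row `t_{ℓ,0} ≤ ℓ + 1`, `t_{ℓ,K_ℓ} = Δ⋆` of half-open cells. [folklore] -/
theorem spinning_nonneg_of_cells {φ : (ℝ → ℝ → ℝ) →ₗ[ℝ] ℝ} {Q : Set (ℝ × ℝ)} {Δstar : ℝ}
    (L : ℕ) (hL : Δstar ≤ (L : ℝ) + 1) (t : ℕ → ℕ → ℝ) (K : ℕ → ℕ)
    (h0 : ∀ ℓ, Even ℓ → ℓ ≠ 0 → ℓ < L → t ℓ 0 ≤ (ℓ : ℝ) + 1)
    (hK : ∀ ℓ, Even ℓ → ℓ ≠ 0 → ℓ < L → t ℓ (K ℓ) = Δstar)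
    (hcell : ∀ ℓ, Even ℓ → ℓ ≠ 0 → ℓ < L → ∀ k < K ℓ, ∀ p ∈ Q,
      ∀ Δ ∈ Ico (t ℓ k) (t ℓ (k + 1)), BlockPositive φ p.1 Δ ℓ) :
    ∀ p ∈ Q, ∀ ℓ : ℕ, Even ℓ → ℓ ≠ 0 → ∀ Δ : ℝ, (ℓ : ℝ) + 1 ≤ Δ → Δ < Δstar →
      BlockPositive φ p.1 Δ ℓ := by
  intro p hp ℓ hev hℓ Δ hΔ1 hΔ2
  have hℓL : ℓ < L := by
    by_contra hge
    have : (L : ℝ) ≤ ℓ := by exact_mod_cast not_lt.1 hge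
    linarith
  exact blockPositive_of_cells_Ico (t ℓ) (K ℓ) (hcell ℓ hev hℓ hℓL) p hp Δ
    ⟨(h0 ℓ hev hℓ hℓL).trans hΔ1, (hK ℓ hev hℓ hℓL) ▸ hΔ2⟩

end Literature.MathematicalPhysics.QuantumFieldTheory.ConformalBootstrap3D
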